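import Summits.AtomisticToContinuum.HydrodynamicLimit.Theorems.OneFlightGossipEngineEquilibriumClampedCollisionalWindowLDRadialVirialAlgebra
import Summits.AtomisticToContinuum.HydrodynamicLimit.Theorems.OneFlightGossipEngineEquilibriumClampedCollisionalWindowLDStubOrbitIntegrable
import Summits.AtomisticToContinuum.HydrodynamicLimit.Theorems.OneFlightGossipEngineEquilibriumClampedCollisionalWindowLDStubMeasurability
import Literature.Analysis.FluidPDE.HardSphereCollisionRecordMeasurable
import Literature.Analysis.FunctionSpaces.TorusCalculusProofs

/-!
# EOS side and measurability for the line `radial-virial-polarization`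
(crux `EquilibriumClampedCollisionalWindowLD`, stmt-AtomisticToContinuum-13733)

* `Arow_some_eq` — momentum rows: the crux's EOS projection `A_k` IS `isoProjection (⅓∂_kφ)` (constants out of every integral;
  the constant term dies by `∫_{𝕋³} ∂_kφ = 0`, `Torus.integral_partialDeriv_eq_zero_holds`);
* `Arow_none_eq` — energy row: `A_e = isoProjection ψ_e + thermalProjection ∇φ` on good orbits (the window integral is split by
  `stub_orbitIntegrable`, p107056); `isoProjection_sub`, `isoProjection_pp_np`, `isoFluct_pp_np` (`A_ψ`, `Y_ψ` affine in `ψ`);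
* a.e.-measurability under `gibbs` of `virN`, `isoProjection`, `thermalProjection`, `isoFluct`, `tracelessFluct`, `thermalFluct`
  for continuous weights (from `stub_measurability`, p107227, and the measurable structure of records).

prover-line-stmt-AtomisticToContinuum-13733-c2-0, 2026-08-16.
-/

noncomputable section

open MeasureTheory Set Filter
open scoped ENNReal BigOperators
open Literature.Analysis.FluidPDE Literature.MathematicalPhysics.KineticTheory
open Literature.Analysis.FunctionSpaces (Torus.partialDeriv Torus.IsSmooth)

namespace Summit.AtomisticToContinuum.HydrodynamicLimit.Theorems.ClampedTransferCoin

namespace RadialVirial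

/-! ### The EOS side: `A_k = A_{ψ_k}`, `A_e = A_{ψ_e} + A_{∇φ}`, and the split `A_ψ = A_{ψ⁺} − A_{ψ⁻}` on good orbits -/

section EOS

variable {σ θ₀ τ : ℝ} {u₀ : V3} {N : ℕ}

/-- The kinetic EOS density of particle `i`: `θ₀σ³Z′ + ⅓(Z−1)|v − u₀|²`. -/
def eosDensity (σ θ₀ : ℝ) (u₀ : V3) (v : V3) : ℝ :=
  θ₀ * σ ^ 3 * deriv hsCompressibility (σ ^ 3) + (1 / 3) * (hsCompressibility (σ ^ 3) - 1) * ‖v - u₀‖ ^ 2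

/-- The isotropic observable `Σ_i ψ(x_i) E_i` of a configuration. -/
def isoObs (σ θ₀ : ℝ) (u₀ : V3) (ψ : T3 → ℝ) (x : Phase N) : ℝ :=
  ∑ i, ψ (x i).1 * eosDensity σ θ₀ u₀ (x i).2

/-- The thermal observable `θ₀(Z−1) Σ_i Σ_l b_l(x_i)(v_i − u₀)_l` of a configuration. -/
def thObs (σ θ₀ : ℝ) (u₀ : V3) (b : Fin 3 → T3 → ℝ) (x : Phase N) : ℝ :=
  θ₀ * (hsCompressibility (σ ^ 3) - 1) * ∑ i, ∑ l, b l (x i).1 * ((x i).2 - u₀) l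

/-- The EOS density is continuous in the velocity. -/
theorem continuous_eosDensity (σ θ₀ : ℝ) (u₀ : V3) : Continuous (eosDensity σ θ₀ u₀) := by
  unfold eosDensity; fun_prop

/-- The isotropic observable of a continuous weight is continuous on phase space. -/
theorem continuous_isoObs {ψ : T3 → ℝ} (hψ : Continuous ψ) : Continuous (isoObs (N := N) σ θ₀ u₀ ψ) := by
  unfold isoObs
  refine continuous_finsetSum _ fun i _ => ?_
  have h1 : Continuous fun x : Phase N => (x i).1 := (continuous_apply i).fst
  have h2 : Continuous fun x : Phase N => (x i).2 := (continuous_apply i).snd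
  exact (hψ.comp h1).mul ((continuous_eosDensity σ θ₀ u₀).comp h2)

/-- The thermal observable of continuous weights is continuous on phase space. -/
theorem continuous_thObs {b : Fin 3 → T3 → ℝ} (hb : ∀ l, Continuous (b l)) :
    Continuous (thObs (N := N) σ θ₀ u₀ b) := by
  unfold thObs
  refine continuous_const.mul (continuous_finsetSum _ fun i _ => continuous_finsetSum _ fun l _ => ?_)
  have h1 : Continuous fun x : Phase N => (x i).1 := (continuous_apply i).fst
  have h2 : Continuous fun x : Phase N => (x i).2 - u₀ := (continuous_apply i).snd.sub continuous_const
  exact ((hb l).comp h1).mul ((EuclideanSpace.proj (𝕜 := ℝ) l).continuous.comp h2)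

/-- `isoProjection` through the isotropic observable. -/
theorem isoProjection_eq (Φ : Flow σ N) (ψ : T3 → ℝ) (z : Phase N) :
    isoProjection σ θ₀ u₀ τ Φ ψ z =
      3 * (∫ r in (0 : ℝ)..window τ N, isoObs σ θ₀ u₀ ψ (Φ.flow r z)) -
        3 * (window τ N * ((((N : ℝ) + 1) * (θ₀ * σ ^ 3 * deriv hsCompressibility (σ ^ 3))) * ∫ x, ψ x)) :=
  rfl

/-- `thermalProjection` through the thermal observable. -/
theorem thermalProjection_eq (Φ : Flow σ N) (b : Fin 3 → T3 → ℝ) (z : Phase N) :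
    thermalProjection σ θ₀ u₀ τ Φ b z = ∫ r in (0 : ℝ)..window τ N, thObs σ θ₀ u₀ b (Φ.flow r z) :=
  rfl

/-- **Momentum rows: `A_k = A_{ψ_k}` exactly** (no integrability needed: constants come out of every integral, and the
constant term dies by `∫_{𝕋³} ∂_kφ = 0`). -/
theorem Arow_some_eq (Φ : Flow σ N) {φ : T3 → ℝ} (hφ : Torus.IsSmooth φ) (k : Fin 3) (z : Phase N) :
    Arow σ θ₀ u₀ τ φ Φ (some k) z = isoProjection σ θ₀ u₀ τ Φ (psiM φ k) z := by
  have hint : ∫ x, psiM φ k x = 0 := by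
    unfold psiM
    rw [integral_const_mul, Literature.Analysis.FunctionSpaces.Torus.integral_partialDeriv_eq_zero_holds hφ k,
      mul_zero]
  rw [isoProjection_eq, hint]
  simp only [mul_zero, sub_zero]
  have e : (fun r => isoObs σ θ₀ u₀ (psiM φ k) (Φ.flow r z)) =
      fun r => 3⁻¹ * ∑ i, Torus.partialDeriv k φ (Φ.flow r z i).1 * eosDensity σ θ₀ u₀ (Φ.flow r z i).2 := by
    funext r
    simp only [isoObs, psiM, Finset.mul_sum]
    refine Finset.sum_congr rfl fun i _ => ?_
    ring
  rw [e, intervalIntegral.integral_const_mul, ← mul_assoc]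
  norm_num
  rfl

/-- **Energy row: `A_e = A_{ψ_e} + A_{∇φ}`** on good orbits (the one place on the EOS side where the window integral is
split, by S7). -/
theorem Arow_none_eq (hσ : 0 < σ) (hσ2 : σ < 1 / 2) (hτ : 0 < τ) (Φ : Flow σ N) {φ : T3 → ℝ}
    (hφ : Torus.IsSmooth φ) {z : Phase N} (hz : z ∈ Φ.good) :
    Arow σ θ₀ u₀ τ φ Φ none z =
      isoProjection σ θ₀ u₀ τ Φ (psiE u₀ φ) z + thermalProjection σ θ₀ u₀ τ Φ (gradF φ) z := by
  have hdφ : ∀ l, Continuous (Torus.partialDeriv l φ) := fun l => (hφ.partialDeriv l).continuous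
  have hint : ∫ x, psiE u₀ φ x = 0 := by
    unfold psiE
    rw [integral_const_mul, integral_finsetSum _ fun l _ => ((hφ.partialDeriv l).integrable).mul_const _]
    simp only [integral_mul_const, Literature.Analysis.FunctionSpaces.Torus.integral_partialDeriv_eq_zero_holds hφ,
      zero_mul, Finset.sum_const_zero, mul_zero]
  rw [isoProjection_eq, thermalProjection_eq, hint]
  simp only [mul_zero, sub_zero]
  -- integrability of the two observables along the orbit (S7)
  have hI1 : IntervalIntegrable (fun r => isoObs σ θ₀ u₀ (psiE u₀ φ) (Φ.flow r z)) volume 0 (window τ N) :=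
    stub_orbitIntegrable σ τ hσ hσ2 hτ N Φ z hz _
      (continuous_isoObs ((continuous_const.mul (continuous_finsetSum _ fun l _ =>
        (hdφ l).mul continuous_const))))
  have hI2 : IntervalIntegrable (fun r => thObs σ θ₀ u₀ (gradF φ) (Φ.flow r z)) volume 0 (window τ N) :=
    stub_orbitIntegrable σ τ hσ hσ2 hτ N Φ z hz _ (continuous_thObs fun l => hdφ l)
  have e1 : 3 * (∫ r in (0 : ℝ)..window τ N, isoObs σ θ₀ u₀ (psiE u₀ φ) (Φ.flow r z)) =
      ∫ r in (0 : ℝ)..window τ N, 3 * isoObs σ θ₀ u₀ (psiE u₀ φ) (Φ.flow r z) :=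
    (intervalIntegral.integral_const_mul _ _).symm
  rw [e1, ← intervalIntegral.integral_add (hI1.const_mul 3) hI2]
  unfold Arow
  refine intervalIntegral.integral_congr fun r _ => ?_
  simp only [isoObs, thObs]
  rw [Finset.mul_sum, Finset.mul_sum, ← Finset.sum_add_distrib]
  refine Finset.sum_congr rfl fun i _ => ?_
  have e2 : (∑ l, u₀ l * Torus.partialDeriv l φ (Φ.flow r z i).1) =
      ∑ l, Torus.partialDeriv l φ (Φ.flow r z i).1 * u₀ l :=
    Finset.sum_congr rfl fun l _ => mul_comm _ _
  rw [e2]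
  simp only [psiE, gradF, eosDensity]
  ring

/-- **Linearity of `A_ψ` in `ψ` on good orbits**: `A_{ψ₁ − ψ₂} = A_{ψ₁} − A_{ψ₂}` for continuous weights. -/
theorem isoProjection_sub (hσ : 0 < σ) (hσ2 : σ < 1 / 2) (hτ : 0 < τ) (Φ : Flow σ N) {ψ₁ ψ₂ : T3 → ℝ}
    (h₁ : Continuous ψ₁) (h₂ : Continuous ψ₂) {z : Phase N} (hz : z ∈ Φ.good) :
    isoProjection σ θ₀ u₀ τ Φ (fun x => ψ₁ x - ψ₂ x) z =
      isoProjection σ θ₀ u₀ τ Φ ψ₁ z - isoProjection σ θ₀ u₀ τ Φ ψ₂ z := by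
  have hI1 : IntervalIntegrable (fun r => isoObs σ θ₀ u₀ ψ₁ (Φ.flow r z)) volume 0 (window τ N) :=
    stub_orbitIntegrable σ τ hσ hσ2 hτ N Φ z hz _ (continuous_isoObs h₁)
  have hI2 : IntervalIntegrable (fun r => isoObs σ θ₀ u₀ ψ₂ (Φ.flow r z)) volume 0 (window τ N) :=
    stub_orbitIntegrable σ τ hσ hσ2 hτ N Φ z hz _ (continuous_isoObs h₂)
  have e1 : (fun r => isoObs σ θ₀ u₀ (fun x => ψ₁ x - ψ₂ x) (Φ.flow r z)) =
      fun r => isoObs σ θ₀ u₀ ψ₁ (Φ.flow r z) - isoObs σ θ₀ u₀ ψ₂ (Φ.flow r z) := by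
    funext r
    simp only [isoObs, ← Finset.sum_sub_distrib]
    refine Finset.sum_congr rfl fun i _ => ?_
    ring
  have e2 : ∫ x, (fun x => ψ₁ x - ψ₂ x) x = (∫ x, ψ₁ x) - ∫ x, ψ₂ x :=
    integral_sub h₁.integrable_unitAddTorus h₂.integrable_unitAddTorus
  rw [isoProjection_eq, isoProjection_eq, isoProjection_eq, e1, intervalIntegral.integral_sub hI1 hI2, e2]
  ring

/-- `A_ψ = A_{ψ⁺} − A_{ψ⁻}` on good orbits. -/
theorem isoProjection_pp_np (hσ : 0 < σ) (hσ2 : σ < 1 / 2) (hτ : 0 < τ) (Φ : Flow σ N) {ψ : T3 → ℝ}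
    (h : Continuous ψ) {z : Phase N} (hz : z ∈ Φ.good) :
    isoProjection σ θ₀ u₀ τ Φ ψ z =
      isoProjection σ θ₀ u₀ τ Φ (pp ψ) z - isoProjection σ θ₀ u₀ τ Φ (np ψ) z := by
  rw [← isoProjection_sub hσ hσ2 hτ Φ (continuous_pp h) (continuous_np h) hz]
  congr 1
  funext x
  exact (pp_sub_np ψ x).symm

/-- `Y_ψ = Y_{ψ⁺} − Y_{ψ⁻}` on good orbits. -/
theorem isoFluct_pp_np (hσ : 0 < σ) (hσ2 : σ < 1 / 2) (hτ : 0 < τ) {V : ℝ} (Φ : Flow σ N) {ψ : T3 → ℝ}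
    (h : Continuous ψ) {z : Phase N} (hz : z ∈ Φ.good) :
    isoFluct σ θ₀ u₀ τ V Φ ψ z = isoFluct σ θ₀ u₀ τ V Φ (pp ψ) z - isoFluct σ θ₀ u₀ τ V Φ (np ψ) z := by
  have e1 : virN σ τ V Φ (fun c => ψ c.fstPos) z =
      virN σ τ V Φ (fun c => pp ψ c.fstPos) z - virN σ τ V Φ (fun c => np ψ c.fstPos) z := by
    rw [← virN_sub Φ hz]
    congr 1
    funext c
    exact (pp_sub_np ψ c.fstPos).symm
  unfold isoFluct
  rw [e1, isoProjection_pp_np hσ hσ2 hτ Φ h hz]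
  ring

end EOS

/-! ### Measurability of the pieces (from S6) -/

section Meas

variable {σ τ V a₀ θ₀ : ℝ} {u₀ : V3} {N : ℕ}

/-- A continuous position weight read at `x_fst` is a measurable record functional. -/
theorem measurable_weight_of_continuous {ψ : T3 → ℝ} (hψ : Continuous ψ) :
    Measurable fun c : Rec N => ψ c.fstPos :=
  hψ.measurable.comp HardSphereCollisionRecord.measurable_fstPos

/-- The quadratic-form weight of a continuous matrix field is a measurable record functional. -/
theorem measurable_quadWeight {S : T3 → Fin 3 → Fin 3 → ℝ} (hS : ∀ a b, Continuous fun x => S x a b) :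
    Measurable (quadWeight (N := N) S) := by
  unfold quadWeight
  refine Finset.measurable_sum _ fun a _ => Finset.measurable_sum _ fun b _ => ?_
  have hω : ∀ i, Measurable fun c : Rec N => c.impactVec i := fun i =>
    (EuclideanSpace.proj (𝕜 := ℝ) i).continuous.measurable.comp HardSphereCollisionRecord.measurable_impactVec
  exact ((hω a).mul ((hS a b).measurable.comp HardSphereCollisionRecord.measurable_fstPos)).mul (hω b)

/-- The thermal weight of continuous fields is a measurable record functional. -/
theorem measurable_thermalWeight (u₀ : V3) {b : Fin 3 → T3 → ℝ} (hb : ∀ l, Continuous (b l)) :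
    Measurable (thermalWeight (N := N) u₀ b) := by
  unfold thermalWeight
  have hω : ∀ i, Measurable fun c : Rec N => c.impactVec i := fun i =>
    (EuclideanSpace.proj (𝕜 := ℝ) i).continuous.measurable.comp HardSphereCollisionRecord.measurable_impactVec
  have hadd : Measurable fun c : Rec N => c.postVel.1 + c.postVel.2 :=
    HardSphereCollisionRecord.measurable_postVel.fst.add HardSphereCollisionRecord.measurable_postVel.snd
  have hV : Measurable fun c : Rec N => (2 : ℝ)⁻¹ • (c.postVel.1 + c.postVel.2) :=
    (continuous_const_smul ((2 : ℝ)⁻¹)).measurable.comp hadd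
  refine (Finset.measurable_sum _ fun l _ => ?_).mul (Finset.measurable_sum _ fun l _ => ?_)
  · exact ((hb l).measurable.comp HardSphereCollisionRecord.measurable_fstPos).mul (hω l)
  · exact ((((EuclideanSpace.proj (𝕜 := ℝ) l).continuous.measurable).comp hV).sub measurable_const).mul (hω l)

/-- The normalised clamped radial virial of a measurable weight is a.e.-measurable under `gibbs` (S6a). -/
theorem aemeasurable_virN (hσ : 0 < σ) (hσ2 : σ < 1 / 2) (hτ : 0 < τ) (Φ : Flow σ N) {Γ : Rec N → ℝ}
    (hΓ : Measurable Γ) : AEMeasurable (virN σ τ V Φ Γ) (gibbs σ a₀ θ₀ u₀ N Φ) := by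
  have h := (stub_measurability σ τ V a₀ θ₀ u₀ hσ hσ2 hτ N Φ).1 Γ hΓ
  exact (h.const_mul (hsDiameter σ N)).const_mul _

/-- The isotropic EOS projection of a continuous weight is a.e.-measurable under `gibbs` (S6b). -/
theorem aemeasurable_isoProjection (hσ : 0 < σ) (hσ2 : σ < 1 / 2) (hτ : 0 < τ) (Φ : Flow σ N) {ψ : T3 → ℝ}
    (hψ : Continuous ψ) : AEMeasurable (isoProjection σ θ₀ u₀ τ Φ ψ) (gibbs σ a₀ θ₀ u₀ N Φ) := by
  have h := (stub_measurability σ τ 0 a₀ θ₀ u₀ hσ hσ2 hτ N Φ).2 _ (continuous_isoObs (σ := σ) (θ₀ := θ₀)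
    (u₀ := u₀) hψ)
  exact (h.const_mul 3).sub_const _

/-- The thermal EOS projection of continuous weights is a.e.-measurable under `gibbs` (S6b). -/
theorem aemeasurable_thermalProjection (hσ : 0 < σ) (hσ2 : σ < 1 / 2) (hτ : 0 < τ) (Φ : Flow σ N)
    {b : Fin 3 → T3 → ℝ} (hb : ∀ l, Continuous (b l)) :
    AEMeasurable (thermalProjection σ θ₀ u₀ τ Φ b) (gibbs σ a₀ θ₀ u₀ N Φ) := by
  have h := (stub_measurability σ τ 0 a₀ θ₀ u₀ hσ hσ2 hτ N Φ).2 _ (continuous_thObs (σ := σ) (θ₀ := θ₀)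
    (u₀ := u₀) hb)
  exact h

/-- `Y_ψ` is a.e.-measurable under `gibbs` for continuous `ψ`. -/
theorem aemeasurable_isoFluct (hσ : 0 < σ) (hσ2 : σ < 1 / 2) (hτ : 0 < τ) (Φ : Flow σ N) {ψ : T3 → ℝ}
    (hψ : Continuous ψ) : AEMeasurable (isoFluct σ θ₀ u₀ τ V Φ ψ) (gibbs σ a₀ θ₀ u₀ N Φ) :=
  (aemeasurable_virN hσ hσ2 hτ Φ (measurable_weight_of_continuous hψ)).sub
    ((aemeasurable_isoProjection hσ hσ2 hτ Φ hψ).const_mul _)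

/-- `T_S` is a.e.-measurable under `gibbs` for continuous `S`. -/
theorem aemeasurable_tracelessFluct (hσ : 0 < σ) (hσ2 : σ < 1 / 2) (hτ : 0 < τ) (Φ : Flow σ N)
    {S : T3 → Fin 3 → Fin 3 → ℝ} (hS : ∀ a b, Continuous fun x => S x a b) :
    AEMeasurable (tracelessFluct σ τ V Φ S) (gibbs σ a₀ θ₀ u₀ N Φ) :=
  aemeasurable_virN hσ hσ2 hτ Φ (measurable_quadWeight hS)

/-- `Θ_b` is a.e.-measurable under `gibbs` for continuous `b`. -/
theorem aemeasurable_thermalFluct (hσ : 0 < σ) (hσ2 : σ < 1 / 2) (hτ : 0 < τ) (Φ : Flow σ N)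
    {b : Fin 3 → T3 → ℝ} (hb : ∀ l, Continuous (b l)) :
    AEMeasurable (thermalFluct σ θ₀ u₀ τ V Φ b) (gibbs σ a₀ θ₀ u₀ N Φ) :=
  (aemeasurable_virN hσ hσ2 hτ Φ (measurable_thermalWeight u₀ hb)).sub
    ((aemeasurable_thermalProjection hσ hσ2 hτ Φ hb).const_mul _)

/-- Registered anchor of this file (= `Arow_some_eq`): the momentum-row EOS projection is `isoProjection (⅓∂_kφ)`. -/
theorem radialVirialEOS_Arow_some_eq {σ θ₀ τ : ℝ} {u₀ : V3} {N : ℕ} (Φ : Flow σ N) {φ : T3 → ℝ} (hφ : Torus.IsSmooth φ) (k : Fin 3) (z : Phase N) : Arow σ θ₀ u₀ τ φ Φ (some k) z = isoProjection σ θ₀ u₀ τ Φ (psiM φ k) z :=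
  Arow_some_eq Φ hφ k z

end Meas

end RadialVirial

end Summit.AtomisticToContinuum.HydrodynamicLimit.Theorems.ClampedTransferCoin

end
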